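import Mathlib.Analysis.InnerProductSpace.l2Space
import Mathlib.Analysis.InnerProductSpace.Adjoint
import HarnessLib

/-!
# The eigenspace of a simple level is a line (stub `stub_eigenspace_simple` of line `twisted_trace_transfer`,
crux `QuarksAsStableAction.StableActionBridge`, stmt-QuantumFields-9737; sub-goal W6a of step E3)

For a self-adjoint bounded operator `A` on a complex Hilbert space with a Hilbert basis of eigenvectors
`A bᵢ = λᵢ bᵢ` (`λᵢ ∈ ℝ`) and an index `i₀` whose level is simple among the basis levels
(`λᵢ = λ_{i₀} ⇒ i = i₀`), every `v` with `A v = λ_{i₀} v` equals `⟪b_{i₀}, v⟫ b_{i₀}`.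
Proof: for each `i`, `⟪bᵢ, A v⟫ = λ_{i₀} ⟪bᵢ, v⟫` (eigen-equation for `v`) and `⟪bᵢ, A v⟫ = ⟪A bᵢ, v⟫ = λᵢ ⟪bᵢ, v⟫`
(self-adjointness), so `(λᵢ − λ_{i₀}) ⟪bᵢ, v⟫ = 0`, whence `⟪bᵢ, v⟫ = 0` for `i ≠ i₀` by simplicity; the expansion
`v = Σᵢ ⟪bᵢ, v⟫ bᵢ` (`HilbertBasis.hasSum_repr`) then collapses to its single term `i₀` (`hasSum_single`,
`HasSum.unique`).  In E3, `A` is the lattice-QCD transfer operator and this is the statement that a simple top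
level has a one-dimensional vacuum sector. Mathlib only. [folklore]
-/

noncomputable section

open scoped InnerProductSpace ComplexConjugate

namespace Summit.QuantumFields.QCD.Cruxes.StableActionBridge.TwistedTraceTransfer

/-- **The eigenspace of a simple level is the line of its basis vector** (sub-goal W6a of E3): for a self-adjoint
bounded operator `A` on a complex Hilbert space with a Hilbert basis of eigenvectors `A bᵢ = λᵢ bᵢ` and
`λᵢ = λ_{i₀} ⇒ i = i₀`, every `v` with `A v = λ_{i₀} v` is `⟪b_{i₀}, v⟫ b_{i₀}`. [folklore] -/
theorem stub_eigenspace_simple : ∀ (E : Type) [NormedAddCommGroup E] [InnerProductSpace ℂ E] [CompleteSpace E]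
    (A : E →L[ℂ] E), IsSelfAdjoint A → ∀ (ι : Type) (b : HilbertBasis ι ℂ E) (lam : ι → ℝ),
    (∀ i, A (b i) = (lam i : ℂ) • b i) → ∀ i₀ : ι, (∀ i, lam i = lam i₀ → i = i₀) →
    ∀ v : E, A v = (lam i₀ : ℂ) • v → v = ⟪b i₀, v⟫_ℂ • b i₀ := by
  intro E _ _ _ A hA ι b lam hb i₀ hsimple v hv
  -- `⟪bᵢ, A v⟫ = λᵢ ⟪bᵢ, v⟫` by self-adjointness and the eigen-equation for `bᵢ`.
  have hbA : ∀ i, ⟪b i, A v⟫_ℂ = (lam i : ℂ) * ⟪b i, v⟫_ℂ := by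
    intro i
    rw [← hA.adjoint_eq, ContinuousLinearMap.adjoint_inner_right, hb i, inner_smul_left,
      Complex.conj_ofReal]
  -- `⟪bᵢ, A v⟫ = λ_{i₀} ⟪bᵢ, v⟫` by the eigen-equation for `v`.
  have hvA : ∀ i, ⟪b i, A v⟫_ℂ = (lam i₀ : ℂ) * ⟪b i, v⟫_ℂ := by
    intro i
    rw [hv, inner_smul_right]
  -- Hence the coefficients of `v` vanish off `i₀`.
  have hzero : ∀ i, i ≠ i₀ → ⟪b i, v⟫_ℂ = 0 := by
    intro i hi
    have hne : (lam i : ℂ) - (lam i₀ : ℂ) ≠ 0 := by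
      rw [sub_ne_zero, Ne, Complex.ofReal_inj]
      exact fun h => hi (hsimple i h)
    have hprod : ((lam i : ℂ) - (lam i₀ : ℂ)) * ⟪b i, v⟫_ℂ = 0 := by
      rw [sub_mul, ← hbA i, ← hvA i, sub_self]
    exact (mul_eq_zero.mp hprod).resolve_left hne
  -- Expand `v` in the Hilbert basis and collapse the sum to the single term `i₀`.
  have hsum : HasSum (fun i => b.repr v i • b i) v := b.hasSum_repr v
  have hsingle : HasSum (fun i => b.repr v i • b i) (b.repr v i₀ • b i₀) := by
    refine hasSum_single i₀ ?_
    intro i hi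
    rw [b.repr_apply_apply, hzero i hi, zero_smul]
  have h := hsum.unique hsingle
  rw [b.repr_apply_apply] at h
  exact h

end Summit.QuantumFields.QCD.Cruxes.StableActionBridge.TwistedTraceTransfer

end
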